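import Literature.AnabelianGeometry.EtaleTheta.FrobenioidThetaDivisorPrincipal
import Literature.AnabelianGeometry.EtaleTheta.FrobenioidThetaDivisorsThm49Stub
import Literature.AlgebraicGeometry.Frobenioids.MonoidFunctors
import Literature.AlgebraicGeometry.Frobenioids.ArithmeticFrobenioidDivisorTransportSquare
import HarnessLib

/-!
# [EtTh] §5, Prop. 5.3: the two F1 binders (F1-Aut, F1-Ψ) of the perfect-`Φ` capstone as THEOREMS for the printed F1
# `principalDivisors` (PROOF-ONLY companion of `FrobenioidThetaDivisorPrincipal.lean`; 0 definitions)

S. Mochizuki, *The étale theta function and its Frobenioid-theoretic manifestations*, Publ. RIMS **45** (2009)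
[MochizukiEtTh2009]: §4 p. 312 (PDF p. 86) («`s′·(s″)⁻¹ ∈ O^×(A^birat)`» for base-equivalent pairs of pre-steps); Prop. 5.3
p. 325–326 (PDF pp. 99–100) and its proof p. 326 («the image of the birational function monoid»); S. Mochizuki, *The
geometry of Frobenioids I*, Kyushu J. Math. **62** (2008) [MochizukiFrdI2008]: Rem. 1.1.1 p. 21
(`Div(φ∘ψ) = Base(ψ)^* Div(φ) + deg_Fr(φ)·Div(ψ)`), Thm. 3.4 (ii)/(v) p. 62–63 (`Ψ` preserves pre-steps / base-equivalent
pairs), Thm. 4.9 p. 88 (`Ψ^Φ` over `Ψ`), Cor. 4.10 p. 90 (`Ψ` induces `Ψ^birat`).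
[cite: MochizukiEtTh2009, Prop 5.3 proof p.326 (PDF p.100)] [cite: MochizukiFrdI2008, Thm. 4.9 p.88]
[cite: MochizukiFrdI2008, Rem. 1.1.1 p.21]

Cell abc-iut, layer L2 ([EtTh] §5), seat abc-iut-L6-d1 (gen 5), row «F1-BIRAT» (abc-iut-L2-lead R453 GO 2026-08-26T14:33Z).
THEOREMS (all hypotheses are binders; «isomorphisms are isometries» `hiso` = abc-iut-w5-d245's binder shape, discharged at
the genuine §5 data by `ThetaFrobenioid.div_iso_eq_one_of_model`):
* F1-Aut OUTRIGHT: `gpMap_pullAut_mem_principalDivisors_iff` — for `g ∈ Aut_C(A)`, `(g·)^gp x` is principal iff `x` is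
  (pull-back along `(g⁻¹)^bs`: `g⁻¹ ≫ s′, g⁻¹ ≫ s″` is again a base-equivalent pair of pre-steps, Rem. 1.1.1); the same
  along any isomorphism `ι : S ≅ T` of `C` (`gpMap_pullIso_mem_principalDivisors_iff`) — the binder `hAP` of
  `DivisorSupportDataQ.geometryOfDivisorsPreserved_of_principalQ` for `principal := principalDivisors 𝔉.pre A_⊚`;
* F1-Ψ: `gpMap_psiPhi_mem_principalDivisors_iff` — `(Ψ^Φ_{A_⊚})^gp x` is principal iff `x` is, for
  `Ψ^Φ_{A_⊚} = psiPhi 𝔉 Ψ ι e` with `e` INDUCED BY `Ψ` in the sense of [FrdI] Thm. 4.9's divisor clause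
  (`(DivisorTransportStub.ofThm49 𝔉).IsInducedBy Ψ A_⊚ e`, abc-iut-w6-d052's LINK (a) shape p445532), GIVEN that `Ψ` and
  `Ψ⁻¹` preserve pre-steps and base-equivalent pairs ([FrdI] Thm. 3.4 (ii)/(v); at the genuine data these are the tree's
  `FrdI.thm34iii_morphisms_of_isOfFSMType` (clauses `IsLinear`, `IsBaseIso`) and `PreFrobenioid.baseEquivalent_map_of_isSlim`,
  cf. abc-iut-w5-d013's p446049) — generators go to generators (`Ψ s′, Ψ s″`), and come from generators
  (`η_A ≫ Ψ⁻¹ s′, η_A ≫ Ψ⁻¹ s″`, unit/counit bookkeeping) — the binder `hP` of the capstone.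
Reused BY NAME: abc-iut-L1's `PreFrobenioidData.degFr_hom_eq_one_of_iso` ([FrdI] Rem. 1.1.1), `gpMap` ([FrdI] §0).
HONEST FRAMING: kernel-checked implications about OUR typed §5 data; nothing here asserts a result of [EtTh] for an actual
curve; typed ≠ proved; no side is taken on [IUTchIII] Cor. 3.12.
-/

namespace Literature.AnabelianGeometry.EtaleTheta

open CategoryTheory
open Literature.AlgebraicGeometry.Frobenioids

universe w v v' u u'

namespace FrobenioidThetaDivisors

variable {C : Type u} [Category.{v} C] {D : Type u'} [Category.{v'} D]

section PreData

variable {S : PreFrobenioidData.{w} C D}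

/-- The divisor `Div(s′) − Div(s″)` of a base-equivalent pair of pre-steps is principal.
[cite: MochizukiEtTh2009, §4 p.312 (PDF p.86)] -/
theorem div_div_mem_principalDivisors {A B : C} {s s' : A ⟶ B} (hs : S.IsPreStep s) (hs' : S.IsPreStep s')
    (hb : S.BaseEquivalent s s') :
    Algebra.GrothendieckGroup.of (S.div s) / Algebra.GrothendieckGroup.of (S.div s') ∈ principalDivisors S A :=
  Subgroup.subset_closure ⟨B, s, s', hs, hs', hb, rfl⟩

/-- The generating set contains `1` (`s′ = s″ = id`). [cite: MochizukiEtTh2009, §4 p.312 (PDF p.86)] -/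
theorem one_mem_principalGenerators (A : C) : (1 : Algebra.GrothendieckGroup (S.Mon (S.base.obj A))) ∈
    principalGenerators S A :=
  ⟨A, 𝟙 A, 𝟙 A, ⟨S.degFr_id A, by change IsIso (S.base.map (𝟙 A)); rw [CategoryTheory.Functor.map_id]; infer_instance⟩,
    ⟨S.degFr_id A, by change IsIso (S.base.map (𝟙 A)); rw [CategoryTheory.Functor.map_id]; infer_instance⟩, rfl,
    by rw [div_self']⟩

/-- The generating set is symmetric (`s′·(s″)⁻¹ ↦ s″·(s′)⁻¹`). [cite: MochizukiEtTh2009, §4 p.312 (PDF p.86)] -/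
theorem inv_mem_principalGenerators {A : C} {x : Algebra.GrothendieckGroup (S.Mon (S.base.obj A))}
    (hx : x ∈ principalGenerators S A) : x⁻¹ ∈ principalGenerators S A := by
  obtain ⟨B, s, s', hs, hs', hb, rfl⟩ := hx
  exact ⟨B, s', s, hs', hs, hb.symm, by rw [inv_div]⟩

/-! ### [FrdI] Rem. 1.1.1 bookkeeping: isomorphisms composed with pre-steps -/

/-- An isomorphism followed by a pre-step is a pre-step. [cite: MochizukiFrdI2008, Def. 1.2 (iii) p.22] -/
theorem isPreStep_iso_hom_comp {A' A B : C} (ι : A' ≅ A) {s : A ⟶ B} (hs : S.IsPreStep s) :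
    S.IsPreStep (ι.hom ≫ s) := by
  refine ⟨?_, ?_⟩
  · change S.degFr (ι.hom ≫ s) = 1
    rw [S.degFr_comp, S.degFr_hom_eq_one_of_iso, show S.degFr s = 1 from hs.1, mul_one]
  · change IsIso (S.base.map (ι.hom ≫ s))
    rw [Functor.map_comp]
    haveI : IsIso (S.base.map s) := hs.2
    infer_instance

/-- A pre-step followed by an isomorphism is a pre-step. [cite: MochizukiFrdI2008, Def. 1.2 (iii) p.22] -/
theorem isPreStep_comp_iso_hom {A B B' : C} {s : A ⟶ B} (hs : S.IsPreStep s) (c : B ≅ B') :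
    S.IsPreStep (s ≫ c.hom) := by
  refine ⟨?_, ?_⟩
  · change S.degFr (s ≫ c.hom) = 1
    rw [S.degFr_comp, S.degFr_hom_eq_one_of_iso, show S.degFr s = 1 from hs.1, one_mul]
  · change IsIso (S.base.map (s ≫ c.hom))
    rw [Functor.map_comp]
    haveI : IsIso (S.base.map s) := hs.2
    infer_instance

/-- `Div(ι ≫ s) = (ι^bs)^* Div(s)` for an isometric `ι` ([FrdI] Rem. 1.1.1). [cite: MochizukiFrdI2008, Rem. 1.1.1 p.21] -/
theorem div_iso_hom_comp {A' A B : C} (ι : A' ≅ A) (hι : S.div ι.hom = 1) (s : A ⟶ B) :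
    S.div (ι.hom ≫ s) = S.pull (S.base.map ι.hom) (S.div s) := by
  rw [S.div_comp, hι, one_pow, mul_one]

/-- `Div(s ≫ c) = Div(s)` for an isometric isomorphism `c` ([FrdI] Rem. 1.1.1). [cite: MochizukiFrdI2008, Rem. 1.1.1 p.21] -/
theorem div_comp_iso_hom {A B B' : C} (s : A ⟶ B) (c : B ≅ B') (hc : S.div c.hom = 1) :
    S.div (s ≫ c.hom) = S.div s := by
  rw [S.div_comp, hc, map_one, one_mul, S.degFr_hom_eq_one_of_iso, PNat.one_coe, pow_one]

/-- Base-equivalence is preserved by pre-composition. [cite: MochizukiFrdI2008, Def. 1.2 (ii) p.21] -/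
theorem baseEquivalent_comp_left {A' A B : C} (f : A' ⟶ A) {s s' : A ⟶ B} (hb : S.BaseEquivalent s s') :
    S.BaseEquivalent (f ≫ s) (f ≫ s') := by
  change S.base.map (f ≫ s) = S.base.map (f ≫ s')
  rw [Functor.map_comp, Functor.map_comp, hb]

/-- Base-equivalence is preserved by post-composition. [cite: MochizukiFrdI2008, Def. 1.2 (ii) p.21] -/
theorem baseEquivalent_comp_right {A B B' : C} {s s' : A ⟶ B} (hb : S.BaseEquivalent s s') (f : B ⟶ B') :
    S.BaseEquivalent (s ≫ f) (s' ≫ f) := by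
  change S.base.map (s ≫ f) = S.base.map (s' ≫ f)
  rw [Functor.map_comp, Functor.map_comp, hb]

/-- Pull-back along `ι⁻¹` undoes pull-back along `ι`. [cite: MochizukiFrdI2008, Def. 1.1 (iv) p.20] -/
theorem pull_iso_inv_hom {A' A : C} (ι : A' ≅ A) (y : S.Mon (S.base.obj A)) :
    S.pull (S.base.map ι.inv) (S.pull (S.base.map ι.hom) y) = y := by
  rw [← S.pull_comp, ← Functor.map_comp, ι.inv_hom_id, CategoryTheory.Functor.map_id, S.pull_id]

/-- … and on `Φ^gp`. [cite: MochizukiFrdI2008, Def. 1.1 (iv) p.20] -/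
theorem gpMap_pull_iso_inv_hom {A' A : C} (ι : A' ≅ A) (x : Algebra.GrothendieckGroup (S.Mon (S.base.obj A))) :
    gpMap (S.pull (S.base.map ι.inv)) (gpMap (S.pull (S.base.map ι.hom)) x) = x := by
  have h : (S.pull (S.base.map ι.inv)).comp (S.pull (S.base.map ι.hom)) = MonoidHom.id _ :=
    MonoidHom.ext fun y => pull_iso_inv_hom ι y
  rw [← MonoidHom.comp_apply, ← gpMap_comp, h, gpMap_id, MonoidHom.id_apply]

/-! ### F1-Aut: pull-back along isomorphisms preserves the principal divisors -/

/-- Pull-back along an isometric isomorphism `ι : A′ ⥲ A` maps principal divisors of `A` to principal divisors of `A′`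
(`(s′, s″) ↦ (ι ≫ s′, ι ≫ s″)`). [cite: MochizukiEtTh2009, §4 p.312 (PDF p.86)] [cite: MochizukiFrdI2008, Rem. 1.1.1 p.21] -/
theorem map_principalDivisors_pull_iso_le {A' A : C} (ι : A' ≅ A) (hι : S.div ι.hom = 1) :
    (principalDivisors S A).map (gpMap (S.pull (S.base.map ι.hom))) ≤ principalDivisors S A' := by
  rw [principalDivisors, MonoidHom.map_closure]
  refine Subgroup.closure_mono ?_
  rintro _ ⟨x, ⟨B, s, s', hs, hs', hb, rfl⟩, rfl⟩
  refine ⟨B, ι.hom ≫ s, ι.hom ≫ s', isPreStep_iso_hom_comp ι hs, isPreStep_iso_hom_comp ι hs',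
    baseEquivalent_comp_left ι.hom hb, ?_⟩
  rw [map_div, gpMap_of, gpMap_of, div_iso_hom_comp ι hι, div_iso_hom_comp ι hι]

/-- **Pull-back along an isomorphism `ι : A′ ⥲ A` of `C` identifies the principal divisors** (isomorphisms being
isometries, `hiso`): `(ι^bs)^* x` is principal at `A′` iff `x` is principal at `A`.
[cite: MochizukiEtTh2009, §4 p.312 (PDF p.86)] [cite: MochizukiFrdI2008, Rem. 1.1.1 p.21] -/
theorem gpMap_pull_iso_mem_principalDivisors_iff (hiso : ∀ ⦃X Y : C⦄ (c : X ≅ Y), S.div c.hom = 1)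
    {A' A : C} (ι : A' ≅ A) (x : Algebra.GrothendieckGroup (S.Mon (S.base.obj A))) :
    gpMap (S.pull (S.base.map ι.hom)) x ∈ principalDivisors S A' ↔ x ∈ principalDivisors S A := by
  constructor
  · intro h
    have h' : gpMap (S.pull (S.base.map ι.inv)) (gpMap (S.pull (S.base.map ι.hom)) x) ∈ principalDivisors S A :=
      map_principalDivisors_pull_iso_le ι.symm (hiso ι.symm) (Subgroup.mem_map.mpr ⟨_, h, rfl⟩)
    rwa [gpMap_pull_iso_inv_hom] at h'
  · intro h
    exact map_principalDivisors_pull_iso_le ι (hiso ι) (Subgroup.mem_map.mpr ⟨x, h, rfl⟩)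

/-! ### F1-Ψ: the `Ψ`-induced isomorphism of divisor monoids preserves the principal divisors -/

section Psi

variable {Ψ : C ≌ C} (E : S.DivisorMonoidIsoOver S Ψ)
  (hE : ∀ ⦃X Y : C⦄ (φ : X ⟶ Y), S.IsPreStep φ → E.iso X (S.div φ) = S.div (Ψ.functor.map φ))
  (hpre : ∀ ⦃X Y : C⦄ (φ : X ⟶ Y), S.IsPreStep φ → S.IsPreStep (Ψ.functor.map φ))
  (hbe : ∀ ⦃X Y : C⦄ (φ ψ : X ⟶ Y), S.BaseEquivalent φ ψ → S.BaseEquivalent (Ψ.functor.map φ) (Ψ.functor.map ψ))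
  (hpre' : ∀ ⦃X Y : C⦄ (φ : X ⟶ Y), S.IsPreStep φ → S.IsPreStep (Ψ.inverse.map φ))
  (hbe' : ∀ ⦃X Y : C⦄ (φ ψ : X ⟶ Y), S.BaseEquivalent φ ψ → S.BaseEquivalent (Ψ.inverse.map φ) (Ψ.inverse.map ψ))
  (hiso : ∀ ⦃X Y : C⦄ (c : X ≅ Y), S.div c.hom = 1)

include hE hpre hbe in
/-- `Ψ^Φ_A` maps principal divisors of `A` to principal divisors of `Ψ(A)`: the pair `(s′, s″)` goes to the
base-equivalent pair of pre-steps `(Ψ s′, Ψ s″)` ([FrdI] Thm. 3.4 (ii)(v)) and `Ψ^Φ_A Div(s) = Div(Ψ s)` (Thm. 4.9).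
[cite: MochizukiFrdI2008, Thm. 4.9 p.88] [cite: MochizukiFrdI2008, Thm. 3.4 (v) p.63] -/
theorem map_principalDivisors_iso_le (A : C) :
    (principalDivisors S A).map (gpMap (E.iso A).toMonoidHom) ≤ principalDivisors S (Ψ.functor.obj A) := by
  rw [principalDivisors, MonoidHom.map_closure]
  refine Subgroup.closure_mono ?_
  rintro _ ⟨x, ⟨B, s, s', hs, hs', hb, rfl⟩, rfl⟩
  refine ⟨Ψ.functor.obj B, Ψ.functor.map s, Ψ.functor.map s', hpre s hs, hpre s' hs', hbe s s' hb, ?_⟩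
  rw [map_div, gpMap_of, gpMap_of, MulEquiv.coe_toMonoidHom, hE s hs, hE s' hs']

/-- Unit/counit bookkeeping: `Ψ (η_A ≫ Ψ⁻¹ s) = s ≫ ε_B⁻¹`. [cite: MochizukiFrdI2008, Thm. 4.9 p.88] -/
theorem functor_map_unit_comp_inverse_map {A B : C} (s : Ψ.functor.obj A ⟶ B) :
    Ψ.functor.map (Ψ.unit.app A ≫ Ψ.inverse.map s : A ⟶ Ψ.inverse.obj B) = s ≫ Ψ.counitInv.app B := by
  rw [Functor.map_comp]
  erw [Ψ.fun_inv_map]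
  erw [Ψ.functor_unit_comp_assoc]
  rfl

include hE hpre' hbe' hiso in
/-- Every principal divisor of `Ψ(A)` is the `Ψ^Φ_A`-image of a principal divisor of `A`: a base-equivalent pair of
pre-steps `s′, s″ : Ψ(A) → B` comes, up to the isometric isomorphism `ε_B`, from the pair
`η_A ≫ Ψ⁻¹ s′, η_A ≫ Ψ⁻¹ s″ : A → Ψ⁻¹(B)` ([FrdI] Thm. 3.4 (ii)(v) for `Ψ⁻¹`).
[cite: MochizukiFrdI2008, Thm. 4.9 p.88] [cite: MochizukiFrdI2008, Thm. 3.4 (v) p.63] -/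
theorem principalDivisors_le_map_iso (A : C) :
    principalDivisors S (Ψ.functor.obj A) ≤ (principalDivisors S A).map (gpMap (E.iso A).toMonoidHom) := by
  rw [principalDivisors, Subgroup.closure_le]
  rintro _ ⟨B, s, s', hs, hs', hb, rfl⟩
  -- the pair `η_A ≫ Ψ⁻¹ s, η_A ≫ Ψ⁻¹ s' : A → Ψ⁻¹(B)` of pre-steps (typed OUT OF `A`), base-equivalent
  have hφ : ∀ t : Ψ.functor.obj A ⟶ B, S.IsPreStep t →
      S.IsPreStep (Ψ.unit.app A ≫ Ψ.inverse.map t : A ⟶ Ψ.inverse.obj B) :=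
    fun t ht => isPreStep_iso_hom_comp (Ψ.unitIso.app A) (hpre' t ht)
  have hbφ : S.BaseEquivalent (Ψ.unit.app A ≫ Ψ.inverse.map s : A ⟶ Ψ.inverse.obj B)
      (Ψ.unit.app A ≫ Ψ.inverse.map s' : A ⟶ Ψ.inverse.obj B) :=
    baseEquivalent_comp_left _ (hbe' s s' hb)
  -- `Ψ^Φ_A Div(η_A ≫ Ψ⁻¹ t) = Div(Ψ(η_A ≫ Ψ⁻¹ t)) = Div(t ≫ ε_B⁻¹) = Div(t)`
  have hdiv : ∀ t : Ψ.functor.obj A ⟶ B, S.IsPreStep t →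
      E.iso A (S.div (Ψ.unit.app A ≫ Ψ.inverse.map t : A ⟶ Ψ.inverse.obj B)) = S.div t := fun t ht => by
    have h1 : E.iso A (S.div (Ψ.unit.app A ≫ Ψ.inverse.map t : A ⟶ Ψ.inverse.obj B)) =
        S.div (Ψ.functor.map (Ψ.unit.app A ≫ Ψ.inverse.map t : A ⟶ Ψ.inverse.obj B)) := hE _ (hφ t ht)
    have h2 : Ψ.functor.map (Ψ.unit.app A ≫ Ψ.inverse.map t : A ⟶ Ψ.inverse.obj B) = t ≫ Ψ.counitInv.app B :=
      functor_map_unit_comp_inverse_map t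
    have h3 : S.div (t ≫ (Ψ.counitIso.app B).symm.hom) = S.div t :=
      div_comp_iso_hom t (Ψ.counitIso.app B).symm (hiso (Ψ.counitIso.app B).symm)
    exact h1.trans ((congrArg S.div h2).trans h3)
  have hmem : Algebra.GrothendieckGroup.of (S.div (Ψ.unit.app A ≫ Ψ.inverse.map s : A ⟶ Ψ.inverse.obj B)) /
      Algebra.GrothendieckGroup.of (S.div (Ψ.unit.app A ≫ Ψ.inverse.map s' : A ⟶ Ψ.inverse.obj B)) ∈
        principalDivisors S A :=
    div_div_mem_principalDivisors (hφ s hs) (hφ s' hs') hbφ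
  refine Subgroup.mem_map.mpr ⟨_, hmem, ?_⟩
  rw [map_div, gpMap_of, gpMap_of, MulEquiv.coe_toMonoidHom, hdiv s hs, hdiv s' hs']

include hE hpre hbe hpre' hbe' hiso in
/-- **`Ψ^Φ_A` IDENTIFIES the principal divisors of `A` and of `Ψ(A)`** ([FrdI] Cor. 4.10: `Ψ` induces `Ψ^birat`;
here on divisors, from Thm. 4.9's divisor clause and Thm. 3.4 (ii)(v) for `Ψ^{±1}`).
[cite: MochizukiFrdI2008, Cor. 4.10 p.90] [cite: MochizukiFrdI2008, Thm. 4.9 p.88] -/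
theorem map_principalDivisors_iso_eq (A : C) :
    (principalDivisors S A).map (gpMap (E.iso A).toMonoidHom) = principalDivisors S (Ψ.functor.obj A) :=
  le_antisymm (map_principalDivisors_iso_le E hE hpre hbe A) (principalDivisors_le_map_iso E hE hpre' hbe' hiso A)

/-- `(e⁻¹)^gp ∘ e^gp = id` for a monoid isomorphism `e`. [cite: MochizukiFrdI2008, §0 p.11] -/
theorem gpMap_symm_gpMap {M N : Type w} [CommMonoid M] [CommMonoid N] (e : M ≃* N) (x : Algebra.GrothendieckGroup M) :
    gpMap e.symm.toMonoidHom (gpMap e.toMonoidHom x) = x := by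
  have h : e.symm.toMonoidHom.comp e.toMonoidHom = MonoidHom.id M := MonoidHom.ext fun y => e.symm_apply_apply y
  rw [← MonoidHom.comp_apply, ← gpMap_comp, h, gpMap_id, MonoidHom.id_apply]

/-- `e^gp ∘ (e⁻¹)^gp = id` for a monoid isomorphism `e`. [cite: MochizukiFrdI2008, §0 p.11] -/
theorem gpMap_gpMap_symm {M N : Type w} [CommMonoid M] [CommMonoid N] (e : M ≃* N) (y : Algebra.GrothendieckGroup N) :
    gpMap e.toMonoidHom (gpMap e.symm.toMonoidHom y) = y :=
  gpMap_symm_gpMap e.symm y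

include hE hpre hbe hpre' hbe' hiso in
/-- **F1-Ψ for the `Ψ`-induced `Ψ^Φ_A`**: `(Ψ^Φ_A)^gp x` is principal at `Ψ(A)` iff `x` is principal at `A`.
[cite: MochizukiFrdI2008, Cor. 4.10 p.90] [cite: MochizukiEtTh2009, Prop 5.3 proof p.326 (PDF p.100)] -/
theorem gpMap_iso_mem_principalDivisors_iff (A : C) (x : Algebra.GrothendieckGroup (S.Mon (S.base.obj A))) :
    gpMap (E.iso A).toMonoidHom x ∈ principalDivisors S (Ψ.functor.obj A) ↔ x ∈ principalDivisors S A := by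
  rw [← map_principalDivisors_iso_eq E hE hpre hbe hpre' hbe' hiso A]
  constructor
  · intro h
    obtain ⟨y, hy, hyx⟩ := Subgroup.mem_map.mp h
    have h' := congrArg (gpMap (E.iso A).symm.toMonoidHom) hyx
    rw [gpMap_symm_gpMap, gpMap_symm_gpMap] at h'
    exact h' ▸ hy
  · exact fun h => Subgroup.mem_map.mpr ⟨x, h, rfl⟩

end Psi

end PreData

/-! ### At the §5 data: `pullIso`, `pullAut`, `psiPhi` -/

section Theta

variable (𝔉 : ThetaFrobenioid.{w} C D)

/-- `pullIso ι` is pull-back along `ι^bs`, as a homomorphism. [cite: MochizukiEtTh2009, Prop 5.3 p.325 (PDF p.99)] -/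
theorem pullIso_toMonoidHom {S T : C} (ι : S ≅ T) :
    (𝔉.pullIso ι).toMonoidHom = 𝔉.pre.pull (𝔉.base.map ι.hom) :=
  MonoidHom.ext fun _ => rfl

/-- `(pullIso ι)⁻¹` is pull-back along `(ι⁻¹)^bs`, as a homomorphism. [cite: MochizukiEtTh2009, Prop 5.3 p.325 (PDF p.99)] -/
theorem pullIso_symm_toMonoidHom {S T : C} (ι : S ≅ T) :
    (𝔉.pullIso ι).symm.toMonoidHom = 𝔉.pre.pull (𝔉.base.map ι.inv) :=
  MonoidHom.ext fun _ => rfl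

/-- **Transport along a chosen isomorphism `ι : S ⥲ T` of `C` identifies the principal divisors** (e.g. the
«isomorphism `Φ(Ψ(A_⊚)) ⥲ Φ(A_⊚)` induced by the chosen isomorphism `Ψ(A_⊚) ⥲ A_⊚`», p. 325).
[cite: MochizukiEtTh2009, Prop 5.3 p.325 (PDF p.99)] [cite: MochizukiFrdI2008, Rem. 1.1.1 p.21] -/
theorem gpMap_pullIso_mem_principalDivisors_iff (hiso : ∀ ⦃X Y : C⦄ (c : X ≅ Y), 𝔉.pre.div c.hom = 1)
    {S T : C} (ι : S ≅ T) (x : Algebra.GrothendieckGroup (𝔉.pre.Mon (𝔉.base.obj T))) :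
    gpMap (𝔉.pullIso ι).toMonoidHom x ∈ principalDivisors 𝔉.pre S ↔ x ∈ principalDivisors 𝔉.pre T := by
  rw [pullIso_toMonoidHom]
  exact gpMap_pull_iso_mem_principalDivisors_iff hiso ι x

/-- The inverse transport. [cite: MochizukiEtTh2009, Prop 5.3 p.325 (PDF p.99)] -/
theorem gpMap_pullIso_symm_mem_principalDivisors_iff (hiso : ∀ ⦃X Y : C⦄ (c : X ≅ Y), 𝔉.pre.div c.hom = 1)
    {S T : C} (ι : S ≅ T) (x : Algebra.GrothendieckGroup (𝔉.pre.Mon (𝔉.base.obj S))) :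
    gpMap (𝔉.pullIso ι).symm.toMonoidHom x ∈ principalDivisors 𝔉.pre T ↔ x ∈ principalDivisors 𝔉.pre S := by
  rw [pullIso_symm_toMonoidHom]
  exact gpMap_pull_iso_mem_principalDivisors_iff hiso ι.symm x

/-- **F1-Aut DISCHARGED** (the binder `hAP` of `DivisorSupportDataQ.geometryOfDivisorsPreserved_of_principalQ`, for
`principal := principalDivisors 𝔉.pre A_⊚`): for every `g ∈ Aut_C(A)`, `g · x = ((g⁻¹)^bs)^* x` is principal iff `x` is
principal — isomorphisms being isometries ([FrdI] Rem. 1.1.1).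
[cite: MochizukiEtTh2009, Prop 5.3 (vi) p.326 (PDF p.100)] [cite: MochizukiFrdI2008, Rem. 1.1.1 p.21] -/
theorem gpMap_pullAut_mem_principalDivisors_iff (hiso : ∀ ⦃X Y : C⦄ (c : X ≅ Y), 𝔉.pre.div c.hom = 1)
    {A : C} (g : Aut A) (x : Algebra.GrothendieckGroup (𝔉.pre.Mon (𝔉.base.obj A))) :
    ThetaFrobenioid.gpMap (𝔉.pullAut g).toMonoidHom x ∈ principalDivisors 𝔉.pre A ↔ x ∈ principalDivisors 𝔉.pre A :=
  gpMap_pullIso_mem_principalDivisors_iff 𝔉 hiso g.symm x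

/-- **F1-Ψ DISCHARGED modulo [FrdI] Thm. 4.9 / Thm. 3.4 (ii)(v)** (the binder `hP` of
`DivisorSupportDataQ.geometryOfDivisorsPreserved_of_principalQ`, for `principal := principalDivisors 𝔉.pre A_⊚`): for
`Ψ^Φ_{A_⊚} = psiPhi 𝔉 Ψ ι e` with `e` INDUCED BY `Ψ` ([FrdI] Thm. 4.9's divisor clause, `DivisorTransportStub.ofThm49`),
and `Ψ`, `Ψ⁻¹` preserving pre-steps and base-equivalent pairs ([FrdI] Thm. 3.4 (ii)(v)), isomorphisms being isometries:
`(Ψ^Φ_{A_⊚})^gp x` is principal iff `x` is.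
[cite: MochizukiEtTh2009, Prop 5.3 proof p.326 (PDF p.100)] [cite: MochizukiFrdI2008, Thm. 4.9 p.88] [cite: MochizukiFrdI2008, Thm. 3.4 (v) p.63] -/
theorem gpMap_psiPhi_mem_principalDivisors_iff {Ψ : C ≌ C} (ι : Ψ.functor.obj 𝔉.Acirc ≅ 𝔉.Acirc)
    {e : 𝔉.PhiAcirc ≃* 𝔉.pre.Mon (𝔉.base.obj (Ψ.functor.obj 𝔉.Acirc))}
    (induced : (DivisorTransportStub.ofThm49 𝔉).IsInducedBy Ψ 𝔉.Acirc e)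
    (hpre : ∀ ⦃X Y : C⦄ (φ : X ⟶ Y), 𝔉.pre.IsPreStep φ → 𝔉.pre.IsPreStep (Ψ.functor.map φ))
    (hbe : ∀ ⦃X Y : C⦄ (φ ψ : X ⟶ Y), 𝔉.pre.BaseEquivalent φ ψ →
      𝔉.pre.BaseEquivalent (Ψ.functor.map φ) (Ψ.functor.map ψ))
    (hpre' : ∀ ⦃X Y : C⦄ (φ : X ⟶ Y), 𝔉.pre.IsPreStep φ → 𝔉.pre.IsPreStep (Ψ.inverse.map φ))
    (hbe' : ∀ ⦃X Y : C⦄ (φ ψ : X ⟶ Y), 𝔉.pre.BaseEquivalent φ ψ →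
      𝔉.pre.BaseEquivalent (Ψ.inverse.map φ) (Ψ.inverse.map ψ))
    (hiso : ∀ ⦃X Y : C⦄ (c : X ≅ Y), 𝔉.pre.div c.hom = 1)
    (x : Algebra.GrothendieckGroup 𝔉.PhiAcirc) :
    ThetaFrobenioid.gpMap (psiPhi 𝔉 Ψ ι e).toMonoidHom x ∈ principalDivisors 𝔉.pre 𝔉.Acirc ↔
      x ∈ principalDivisors 𝔉.pre 𝔉.Acirc := by
  obtain ⟨E, rfl, hE⟩ := induced
  have hcomp : (psiPhi 𝔉 Ψ ι (E.iso 𝔉.Acirc)).toMonoidHom =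
      (𝔉.pullIso ι).symm.toMonoidHom.comp (E.iso 𝔉.Acirc).toMonoidHom :=
    MonoidHom.ext fun _ => rfl
  show gpMap (psiPhi 𝔉 Ψ ι (E.iso 𝔉.Acirc)).toMonoidHom x ∈ principalDivisors 𝔉.pre 𝔉.Acirc ↔
    x ∈ principalDivisors 𝔉.pre 𝔉.Acirc
  rw [hcomp, gpMap_comp, MonoidHom.comp_apply, gpMap_pullIso_symm_mem_principalDivisors_iff 𝔉 hiso ι,
    gpMap_iso_mem_principalDivisors_iff E hE hpre hbe hpre' hbe' hiso]

end Theta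

end FrobenioidThetaDivisors

end Literature.AnabelianGeometry.EtaleTheta
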